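import Mathlib
import HarnessLib
import Summits.BirchSwinnertonDyer.BirchSwinnertonDyer.Theorems.ManinLocalTwoThreeModularDegreeOfLatticeOptimal
import Literature.NumberTheory.EllipticCurves.ModularParametrizationDegree

/-!
# Degree-minimal ⟹ lattice-optimal: the two optimality currencies agree

Lead p1 gen 13 (route `ManinLocalTwoThree`; supports the C3 crux item stmt-BirchSwinnertonDyer-22968; route-independent).  Companion of
`ModularDegreeOfLatticeOptimal.lean` (p710128: a LATTICE-optimal datum `D`, `Λ_W = c Λ_f`, has minimal modular degree among all
data of the same level with the same newform).  Here the CONVERSE: if `D` is lattice-optimal and `D'` (same level, same newform,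
any model `W'`) is NOT lattice-optimal, then `deg D' ≥ 2 · deg D` (`two_mul_modularDegree_le_of_not_latticeOptimal`); hence a datum
of degree `< 2 deg D` — in particular a DEGREE-MINIMAL datum — is lattice-optimal (`latticeOptimal_of_modularDegree_le`,
`latticeOptimal_of_forall_modularDegree_le`), and `D'` is lattice-optimal iff `deg D' = deg D` (`latticeOptimal_iff_modularDegree_eq`).
Finally DEGREE MULTIPLICATIVITY: `deg D' = k · deg D` with `k ≥ 1` the number of target points (`exists_modularDegree_eq_mul_of_latticeOptimal`:
a generic `φ_{D'}`-fibre is the disjoint union of the generic `φ_D`-fibres over the points `unif_W(c u)`, `c' u − z' ∈ Λ_{W'}`), so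
`deg D ∣ deg D'` (`modularDegree_dvd_of_latticeOptimal`; `k = [Λ_{W'} : c' Λ_f]` is the degree of the isogeny `E_f → E'`).
So, inside a class that contains a lattice-optimal datum (the strong Weil curve with its optimal parametrisation), the
degree-minimality currency of `abs_maninConstant_eq_one_of_isSemistable` / the congruence-number files and the lattice currency
of the C2/C3 cruxes single out the same data.

Proof (fibre counting on `deg_spec`, as in the companion file): pick `l ∈ Λ_{W'}` with `l / c' ∉ Λ_f` (non-optimality, `c' ≠ 0`).  For
a parameter `z' ∈ ℂ` put `u₁ = z'/c'`, `u₂ = (z' + l)/c'`.  The fibres `F_i = {Γ₀(N)τ : φ_D(τ) = unif_W(c u_i)}` both lie in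
`F' = {Γ₀(N)τ : φ_{D'}(τ) = unif_{W'}(z')}` (`c' u_i − z' ∈ Λ_{W'}`, companion lemma `fiber_subset_fiber_of_latticeOptimal`), and they are
DISJOINT: `φ_D` factors through `Y₀(N)` (`φ_eq_of_mk_eq_mk_holds'`) and `unif_W(c u₁) ≠ unif_W(c u₂)` because `c (u₁ − u₂) = −c l/c' ∈ Λ_W =
c Λ_f` would force `l / c' ∈ Λ_f`.  Off a countable set of parameters `z'` all three fibres have their generic sizes `deg D`, `deg D`,
`deg D'`, whence `2 deg D ≤ deg D'`.

HONEST FRAMING: elementary and unconditional; nothing about Manin constants, C2/C3 or BSD is proved here.  beyond-print theorem: NO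
(folklore: Zagier 1985 §1, Cremona §2.10 — the strong Weil parametrisation is the unique one of minimal degree).
-/

set_option linter.dupNamespace false
set_option autoImplicit false

noncomputable section

open scoped MatrixGroups ModularForm
open CongruenceSubgroup UpperHalfPlane Literature.NumberTheory.EllipticCurves
  Literature.NumberTheory.EllipticCurves.ModularForms

namespace Summit.BirchSwinnertonDyer.BirchSwinnertonDyer.Theorems.ManinLocalTwoThree

variable {W : WeierstrassCurve ℚ} {N : ℕ} [NeZero N]

/-- Fibres of `φ_D` over two distinct points of `E(ℂ)` are disjoint subsets of `Y₀(N)`: `φ_D` is constant on `Γ₀(N)`-orbits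
(`φ_eq_of_mk_eq_mk_holds'`, unconditional). -/
theorem disjoint_fiber_of_ne (D : ModularParametrizationData W N) {P₁ P₂ : (W.baseChange ℂ).toAffine.Point} (hP : P₁ ≠ P₂) :
    Disjoint {y : Y0 N | ∃ τ : ℍ, Y0.mk N τ = y ∧ D.φ τ = P₁} {y : Y0 N | ∃ τ : ℍ, Y0.mk N τ = y ∧ D.φ τ = P₂} := by
  have hinv : ∀ {τ τ' : ℍ}, Y0.mk N τ = Y0.mk N τ' → D.φ τ = D.φ τ' := D.φ_eq_of_mk_eq_mk_holds'
  rw [Set.disjoint_left]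
  rintro y ⟨τ₁, h₁, hφ₁⟩ ⟨τ₂, h₂, hφ₂⟩
  exact hP (hφ₁.symm.trans ((hinv (h₁.trans h₂.symm)).trans hφ₂))

/-- Fibre inclusion, translated form: for `D` lattice-optimal and `D'` with the same newform, if `c' u − z' ∈ Λ_{W'}` then the orbits
with `φ_D(τ) = unif_W(c u)` are among those with `φ_{D'}(τ) = unif_{W'}(z')`. -/
theorem fiber_subset_fiber_of_latticeOptimal_of_mem (D : ModularParametrizationData W N)
    (hL : ∀ z ∈ D.L.lattice, ∃ w ∈ periodLattice D.f, z = D.c * w)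
    {W' : WeierstrassCurve ℚ} (D' : ModularParametrizationData W' N) (hf : D'.f = D.f) (u z' : ℂ)
    (hu : (D'.c : ℂ) * u - z' ∈ D'.L.lattice) :
    {y : Y0 N | ∃ τ : ℍ, Y0.mk N τ = y ∧ D.φ τ = D.uniformize ((D.c : ℂ) * u)} ⊆
      {y : Y0 N | ∃ τ : ℍ, Y0.mk N τ = y ∧ D'.φ τ = D'.uniformize z'} := by
  have hz : D'.uniformize ((D'.c : ℂ) * u) = D'.uniformize z' := by
    rw [← sub_eq_zero, ← map_sub, D'.uniformize_eq_zero_iff]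
    exact hu
  have h := fiber_subset_fiber_of_latticeOptimal D hL D' hf u
  rw [hz] at h
  exact h

/-- **Non-optimal data have at least twice the optimal degree.**  If `D` is lattice-optimal (`Λ_W = c Λ_f`), `D'` has the same level and
newform, and `D'` is NOT lattice-optimal, then `2 · deg D ≤ deg D'`: two disjoint generic `φ_D`-fibres of size `deg D` sit inside one
generic `φ_{D'}`-fibre of size `deg D'`. -/
theorem two_mul_modularDegree_le_of_not_latticeOptimal (D : ModularParametrizationData W N)
    (hL : ∀ z ∈ D.L.lattice, ∃ w ∈ periodLattice D.f, z = D.c * w)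
    {W' : WeierstrassCurve ℚ} (D' : ModularParametrizationData W' N) (hf : D'.f = D.f)
    (hL' : ¬ ∀ z ∈ D'.L.lattice, ∃ w ∈ periodLattice D'.f, z = D'.c * w) :
    2 * D.modularDegree ≤ D'.modularDegree := by
  classical
  have hc : (D.c : ℂ) ≠ 0 := by exact_mod_cast D.maninConstant_ne_zero_holds
  have hc' : (D'.c : ℂ) ≠ 0 := by exact_mod_cast D'.maninConstant_ne_zero_holds
  -- a lattice vector of `Λ_{W'}` off `c' Λ_f`
  obtain ⟨l, hl, hlf⟩ : ∃ l ∈ D'.L.lattice, l / (D'.c : ℂ) ∉ periodLattice D.f := by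
    by_contra h
    apply hL'
    intro z hz
    have hzf : z / (D'.c : ℂ) ∈ periodLattice D.f := by
      by_contra hz'
      exact h ⟨z, hz, hz'⟩
    refine ⟨z / (D'.c : ℂ), hf ▸ hzf, ?_⟩
    rw [← mul_div_assoc, mul_div_cancel_left₀ z hc']
  -- the countable set of bad parameters `z'`
  have hS := countable_setOf_fiberOrbitCount_ne D
  have hinj₁ : Function.Injective (fun z' : ℂ => z' / (D'.c : ℂ)) := by
    intro a b h
    simpa [div_left_inj' hc'] using h
  have hinj₂ : Function.Injective (fun z' : ℂ => (z' + l) / (D'.c : ℂ)) := by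
    intro a b h
    have h' : a + l = b + l := by simpa [div_left_inj' hc'] using h
    exact add_right_cancel h'
  have h1 : ((fun z' : ℂ => z' / (D'.c : ℂ)) ⁻¹'
      {u : ℂ | D.fiberOrbitCount (D.uniformize ((D.c : ℂ) * u)) ≠ D.modularDegree}).Countable :=
    hS.preimage hinj₁
  have h2 : ((fun z' : ℂ => (z' + l) / (D'.c : ℂ)) ⁻¹'
      {u : ℂ | D.fiberOrbitCount (D.uniformize ((D.c : ℂ) * u)) ≠ D.modularDegree}).Countable :=
    hS.preimage hinj₂
  have h3 : (D'.uniformize ⁻¹' {P | D'.fiberOrbitCount P ≠ D'.modularDegree}).Countable :=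
    countable_preimage_uniformize D' D'.finite_setOf_fiberOrbitCount_ne.countable
  obtain ⟨z', hz'⟩ : ∃ z' : ℂ, z' ∉ ((fun z' : ℂ => z' / (D'.c : ℂ)) ⁻¹'
        {u : ℂ | D.fiberOrbitCount (D.uniformize ((D.c : ℂ) * u)) ≠ D.modularDegree} ∪
      (fun z' : ℂ => (z' + l) / (D'.c : ℂ)) ⁻¹'
        {u : ℂ | D.fiberOrbitCount (D.uniformize ((D.c : ℂ) * u)) ≠ D.modularDegree}) ∪
      D'.uniformize ⁻¹' {P | D'.fiberOrbitCount P ≠ D'.modularDegree} := by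
    by_contra h
    exact not_countable_complex (((h1.union h2).union h3).mono fun z _ => by
      by_contra hz
      exact h ⟨z, hz⟩)
  -- the two parameters and the three generic fibre counts
  obtain ⟨u₁, hu₁⟩ : ∃ u₁ : ℂ, u₁ = z' / (D'.c : ℂ) := ⟨_, rfl⟩
  obtain ⟨u₂, hu₂⟩ : ∃ u₂ : ℂ, u₂ = (z' + l) / (D'.c : ℂ) := ⟨_, rfl⟩
  have g1 : D.fiberOrbitCount (D.uniformize ((D.c : ℂ) * u₁)) = D.modularDegree := by
    rw [hu₁]
    by_contra h
    exact hz' (Or.inl (Or.inl h))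
  have g2 : D.fiberOrbitCount (D.uniformize ((D.c : ℂ) * u₂)) = D.modularDegree := by
    rw [hu₂]
    by_contra h
    exact hz' (Or.inl (Or.inr h))
  have g3 : D'.fiberOrbitCount (D'.uniformize z') = D'.modularDegree := by
    by_contra h
    exact hz' (Or.inr h)
  -- the fibres as subsets of `Y₀(N)`
  set F₁ : Set (Y0 N) := {y | ∃ τ : ℍ, Y0.mk N τ = y ∧ D.φ τ = D.uniformize ((D.c : ℂ) * u₁)} with hF₁
  set F₂ : Set (Y0 N) := {y | ∃ τ : ℍ, Y0.mk N τ = y ∧ D.φ τ = D.uniformize ((D.c : ℂ) * u₂)} with hF₂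
  set F' : Set (Y0 N) := {y | ∃ τ : ℍ, Y0.mk N τ = y ∧ D'.φ τ = D'.uniformize z'} with hF'
  have hcard₁ : Nat.card F₁ = D.modularDegree := g1
  have hcard₂ : Nat.card F₂ = D.modularDegree := g2
  have hcard' : Nat.card F' = D'.modularDegree := g3
  have hpos : 0 < D.modularDegree := D.deg_pos
  have hpos' : 0 < D'.modularDegree := D'.deg_pos
  have hfin₁ : F₁.Finite := by
    have : Finite F₁ := Nat.finite_of_card_ne_zero (by rw [hcard₁]; exact hpos.ne')
    exact F₁.toFinite
  have hfin₂ : F₂.Finite := by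
    have : Finite F₂ := Nat.finite_of_card_ne_zero (by rw [hcard₂]; exact hpos.ne')
    exact F₂.toFinite
  have hfin' : F'.Finite := by
    have : Finite F' := Nat.finite_of_card_ne_zero (by rw [hcard']; exact hpos'.ne')
    exact F'.toFinite
  -- both `φ_D`-fibres lie in the `φ_{D'}`-fibre
  have hsub₁ : F₁ ⊆ F' := by
    refine fiber_subset_fiber_of_latticeOptimal_of_mem D hL D' hf u₁ z' ?_
    have h0 : (D'.c : ℂ) * u₁ - z' = 0 := by
      rw [hu₁, ← mul_div_assoc, mul_div_cancel_left₀ z' hc', sub_self]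
    rw [h0]
    exact zero_mem _
  have hsub₂ : F₂ ⊆ F' := by
    refine fiber_subset_fiber_of_latticeOptimal_of_mem D hL D' hf u₂ z' ?_
    have h0 : (D'.c : ℂ) * u₂ - z' = l := by
      rw [hu₂, ← mul_div_assoc, mul_div_cancel_left₀ _ hc', add_sub_cancel_left]
    rw [h0]
    exact hl
  -- and they are disjoint: the two target points of `E(ℂ)` differ
  have hne : D.uniformize ((D.c : ℂ) * u₁) ≠ D.uniformize ((D.c : ℂ) * u₂) := by
    intro h
    have hmem : (D.c : ℂ) * u₁ - (D.c : ℂ) * u₂ ∈ D.L.lattice := by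
      rw [← D.uniformize_eq_zero_iff, map_sub, sub_eq_zero]
      exact h
    obtain ⟨w, hw, hcw⟩ := hL _ hmem
    have hw' : u₁ - u₂ = w := by
      apply mul_left_cancel₀ hc
      rw [mul_sub, hcw]
    apply hlf
    have hl' : l / (D'.c : ℂ) = -w := by
      rw [← hw', hu₁, hu₂]
      ring
    rw [hl']
    exact neg_mem hw
  have hdisj : Disjoint F₁ F₂ := disjoint_fiber_of_ne D hne
  -- count
  have hunion : (F₁ ∪ F₂).ncard = F₁.ncard + F₂.ncard := Set.ncard_union_eq hdisj hfin₁ hfin₂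
  have hle : (F₁ ∪ F₂).ncard ≤ F'.ncard := Set.ncard_le_ncard (Set.union_subset hsub₁ hsub₂) hfin'
  rw [← Nat.card_coe_set_eq, ← Nat.card_coe_set_eq, ← Nat.card_coe_set_eq, hcard₁, hcard₂] at hunion
  rw [← Nat.card_coe_set_eq, ← Nat.card_coe_set_eq, hcard', hunion] at hle
  omega

/-- A datum of degree `< 2 · deg D` (with `D` lattice-optimal, same level and newform) is lattice-optimal. -/
theorem latticeOptimal_of_modularDegree_lt_two_mul (D : ModularParametrizationData W N)
    (hL : ∀ z ∈ D.L.lattice, ∃ w ∈ periodLattice D.f, z = D.c * w)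
    {W' : WeierstrassCurve ℚ} (D' : ModularParametrizationData W' N) (hf : D'.f = D.f)
    (hlt : D'.modularDegree < 2 * D.modularDegree) :
    ∀ z ∈ D'.L.lattice, ∃ w ∈ periodLattice D'.f, z = D'.c * w := by
  by_contra h
  exact absurd (two_mul_modularDegree_le_of_not_latticeOptimal D hL D' hf h) (not_le.mpr hlt)

/-- A datum of degree `≤ deg D` (with `D` lattice-optimal, same level and newform) is lattice-optimal — so a DEGREE-MINIMAL datum of a
class containing a lattice-optimal one is lattice-optimal. -/
theorem latticeOptimal_of_modularDegree_le (D : ModularParametrizationData W N)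
    (hL : ∀ z ∈ D.L.lattice, ∃ w ∈ periodLattice D.f, z = D.c * w)
    {W' : WeierstrassCurve ℚ} (D' : ModularParametrizationData W' N) (hf : D'.f = D.f)
    (hle : D'.modularDegree ≤ D.modularDegree) :
    ∀ z ∈ D'.L.lattice, ∃ w ∈ periodLattice D'.f, z = D'.c * w := by
  have hpos : 0 < D.modularDegree := D.deg_pos
  exact latticeOptimal_of_modularDegree_lt_two_mul D hL D' hf (by omega)

/-- **The two currencies agree**: next to a lattice-optimal `D`, a datum `D'` with the same level and newform is lattice-optimal iff it has
the same (= the minimal) modular degree. -/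
theorem latticeOptimal_iff_modularDegree_eq (D : ModularParametrizationData W N)
    (hL : ∀ z ∈ D.L.lattice, ∃ w ∈ periodLattice D.f, z = D.c * w)
    {W' : WeierstrassCurve ℚ} (D' : ModularParametrizationData W' N) (hf : D'.f = D.f) :
    (∀ z ∈ D'.L.lattice, ∃ w ∈ periodLattice D'.f, z = D'.c * w) ↔ D'.modularDegree = D.modularDegree :=
  ⟨fun hL' => (modularDegree_eq_of_latticeOptimal D hL D' hL' hf).symm,
    fun h => latticeOptimal_of_modularDegree_le D hL D' hf h.le⟩

/-- **Degree-minimal ⟹ lattice-optimal.**  If `D'` has minimal modular degree among all data of its level with its newform (the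
hypothesis form of `abs_maninConstant_eq_one_of_isSemistable`), and SOME lattice-optimal datum `D` with that level and newform exists
(the strong Weil curve of the class with its optimal parametrisation), then `D'` is lattice-optimal: `Λ_{W'} = c' Λ_f`. -/
theorem latticeOptimal_of_forall_modularDegree_le {W' : WeierstrassCurve ℚ} (D' : ModularParametrizationData W' N)
    (hmin : ∀ (W'' : WeierstrassCurve ℚ) [W''.IsElliptic] (D'' : ModularParametrizationData W'' N),
      D''.f = D'.f → D'.modularDegree ≤ D''.modularDegree)
    (W : WeierstrassCurve ℚ) [W.IsElliptic] (D : ModularParametrizationData W N)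
    (hL : ∀ z ∈ D.L.lattice, ∃ w ∈ periodLattice D.f, z = D.c * w) (hf : D'.f = D.f) :
    ∀ z ∈ D'.L.lattice, ∃ w ∈ periodLattice D'.f, z = D'.c * w :=
  latticeOptimal_of_modularDegree_le D hL D' hf (hmin W D hf.symm)


/-- **Degree multiplicativity along the class.**  If `D` is lattice-optimal and `D'` has the same level and newform, then
`deg D' = k · deg D` for a positive integer `k` (the number of `Λ_f`-classes in `c'⁻¹(z' + Λ_{W'})`, i.e. the index `[Λ_{W'} : c' Λ_f]`,
the degree of the isogeny `E_f → E'` through which `φ_{D'}` factors): a generic `φ_{D'}`-fibre is the DISJOINT union, over the finitely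
many target points `unif_W(c u)` with `c' u − z' ∈ Λ_{W'}`, of generic `φ_D`-fibres, each of size `deg D`. -/
theorem exists_modularDegree_eq_mul_of_latticeOptimal (D : ModularParametrizationData W N)
    (hL : ∀ z ∈ D.L.lattice, ∃ w ∈ periodLattice D.f, z = D.c * w)
    {W' : WeierstrassCurve ℚ} (D' : ModularParametrizationData W' N) (hf : D'.f = D.f) :
    ∃ k : ℕ, 0 < k ∧ D'.modularDegree = k * D.modularDegree := by
  classical
  have hinv : ∀ {τ τ' : ℍ}, Y0.mk N τ = Y0.mk N τ' → D.φ τ = D.φ τ' := D.φ_eq_of_mk_eq_mk_holds'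
  -- the countable set of bad parameters `z'`
  have hS := countable_setOf_fiberOrbitCount_ne D
  haveI : Countable D'.L.lattice := Countable.of_equiv _ D'.L.latticeEquivProd.toEquiv.symm
  have hlat' : (D'.L.lattice : Set ℂ).Countable := Set.countable_coe_iff.mp inferInstance
  have hSbad : (⋃ u ∈ {u : ℂ | D.fiberOrbitCount (D.uniformize ((D.c : ℂ) * u)) ≠ D.modularDegree},
      (fun l : ℂ => (D'.c : ℂ) * u - l) '' (D'.L.lattice : Set ℂ)).Countable :=
    hS.biUnion fun u _ => hlat'.image _
  have h3 : (D'.uniformize ⁻¹' {P | D'.fiberOrbitCount P ≠ D'.modularDegree}).Countable :=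
    countable_preimage_uniformize D' D'.finite_setOf_fiberOrbitCount_ne.countable
  obtain ⟨z', hz'⟩ : ∃ z' : ℂ, z' ∉ (⋃ u ∈ {u : ℂ | D.fiberOrbitCount (D.uniformize ((D.c : ℂ) * u)) ≠ D.modularDegree},
      (fun l : ℂ => (D'.c : ℂ) * u - l) '' (D'.L.lattice : Set ℂ)) ∪
      D'.uniformize ⁻¹' {P | D'.fiberOrbitCount P ≠ D'.modularDegree} := by
    by_contra h
    exact not_countable_complex ((hSbad.union h3).mono fun z _ => by
      by_contra hz
      exact h ⟨z, hz⟩)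
  -- every admissible parameter `u` is generic for `D`, and `z'` is generic for `D'`
  have good : ∀ u : ℂ, (D'.c : ℂ) * u - z' ∈ D'.L.lattice →
      D.fiberOrbitCount (D.uniformize ((D.c : ℂ) * u)) = D.modularDegree := by
    intro u hu
    by_contra hne
    apply hz'
    refine Or.inl (Set.mem_iUnion₂.mpr ⟨u, hne, (D'.c : ℂ) * u - z', hu, ?_⟩)
    show (D'.c : ℂ) * u - ((D'.c : ℂ) * u - z') = z'
    ring
  have good' : D'.fiberOrbitCount (D'.uniformize z') = D'.modularDegree := by
    by_contra h
    exact hz' (Or.inr h)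
  -- the target points, the fibres
  set T : Set (W.baseChange ℂ).toAffine.Point :=
    {P | ∃ u : ℂ, (D'.c : ℂ) * u - z' ∈ D'.L.lattice ∧ P = D.uniformize ((D.c : ℂ) * u)} with hT
  set F : (W.baseChange ℂ).toAffine.Point → Set (Y0 N) := fun P => {y | ∃ τ : ℍ, Y0.mk N τ = y ∧ D.φ τ = P} with hF
  set F' : Set (Y0 N) := {y | ∃ τ : ℍ, Y0.mk N τ = y ∧ D'.φ τ = D'.uniformize z'} with hF'
  have hpos : 0 < D.modularDegree := D.deg_pos
  have hpos' : 0 < D'.modularDegree := D'.deg_pos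
  have hcard' : F'.ncard = D'.modularDegree := good'
  have hfin' : F'.Finite := Set.finite_of_ncard_ne_zero (by rw [hcard']; exact hpos'.ne')
  have hFcard : ∀ P ∈ T, (F P).ncard = D.modularDegree := by
    rintro P ⟨u, hu, rfl⟩
    exact good u hu
  have hFfin : ∀ P ∈ T, (F P).Finite := fun P hP =>
    Set.finite_of_ncard_ne_zero (by rw [hFcard P hP]; exact hpos.ne')
  -- the generic `φ_{D'}`-fibre is the union of the `φ_D`-fibres over `T`
  have hcover : F' = ⋃ P ∈ T, F P := by
    ext y
    constructor
    · rintro ⟨τ, hτ, hφ⟩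
      have hu : (D'.c : ℂ) * eichlerIntegral D'.f τ - z' ∈ D'.L.lattice := by
        rw [← D'.uniformize_eq_zero_iff, map_sub, sub_eq_zero]
        exact hφ
      refine Set.mem_iUnion₂.mpr ⟨D.uniformize ((D.c : ℂ) * eichlerIntegral D'.f τ), ⟨_, hu, rfl⟩, τ, hτ, ?_⟩
      rw [hf]
      rfl
    · intro hy
      obtain ⟨P, hP, hyP⟩ := Set.mem_iUnion₂.mp hy
      obtain ⟨u, hu, rfl⟩ := hP
      exact fiber_subset_fiber_of_latticeOptimal_of_mem D hL D' hf u z' hu hyP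
  -- `T` is finite: it is the image of the finite fibre `F'` under `y ↦ φ_D(any lift of y)`
  have hTfin : T.Finite := by
    refine (hfin'.image fun y : Y0 N => D.φ (Function.surjInv (Y0.mk_surjective N) y)).subset ?_
    intro P hP
    obtain ⟨hne, -⟩ := Nat.card_ne_zero.mp (by
      rw [Nat.card_coe_set_eq, hFcard P hP]; exact hpos.ne' : Nat.card (F P) ≠ 0)
    obtain ⟨⟨y, τ, hτ, hφ⟩⟩ := hne
    refine ⟨y, ?_, ?_⟩
    · rw [hcover]
      exact Set.mem_iUnion₂.mpr ⟨P, hP, τ, hτ, hφ⟩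
    · have hmk : Y0.mk N (Function.surjInv (Y0.mk_surjective N) y) = Y0.mk N τ := by
        rw [Function.surjInv_eq (Y0.mk_surjective N) y]
        exact hτ.symm
      show D.φ (Function.surjInv (Y0.mk_surjective N) y) = P
      rw [← hφ]
      exact hinv hmk
  -- pairwise disjoint
  have hdisj : T.PairwiseDisjoint F := fun P _ Q _ hPQ => disjoint_fiber_of_ne D hPQ
  -- `T` is nonempty (`u = z'/c'` is admissible)
  have hc' : (D'.c : ℂ) ≠ 0 := by exact_mod_cast D'.maninConstant_ne_zero_holds
  have hTne : T.Nonempty := by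
    refine ⟨D.uniformize ((D.c : ℂ) * (z' / (D'.c : ℂ))), z' / (D'.c : ℂ), ?_, rfl⟩
    have h0 : (D'.c : ℂ) * (z' / (D'.c : ℂ)) - z' = 0 := by
      rw [← mul_div_assoc, mul_div_cancel_left₀ z' hc', sub_self]
    rw [h0]
    exact zero_mem _
  -- count
  have hsum : (⋃ P ∈ T, F P).ncard = ∑ᶠ P ∈ T, (F P).ncard := hTfin.ncard_biUnion hFfin hdisj
  rw [finsum_mem_congr rfl hFcard, finsum_mem_eq_finite_toFinset_sum _ hTfin, Finset.sum_const, smul_eq_mul,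
    ← Set.ncard_eq_toFinset_card T hTfin] at hsum
  refine ⟨T.ncard, ?_, ?_⟩
  · rw [Set.ncard_pos hTfin]
    exact hTne
  · rw [← hcard', hcover, hsum]

/-- `deg D ∣ deg D'` for `D` lattice-optimal and `D'` of the same level and newform. -/
theorem modularDegree_dvd_of_latticeOptimal (D : ModularParametrizationData W N)
    (hL : ∀ z ∈ D.L.lattice, ∃ w ∈ periodLattice D.f, z = D.c * w)
    {W' : WeierstrassCurve ℚ} (D' : ModularParametrizationData W' N) (hf : D'.f = D.f) :
    D.modularDegree ∣ D'.modularDegree := by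
  obtain ⟨k, -, hk⟩ := exists_modularDegree_eq_mul_of_latticeOptimal D hL D' hf
  exact ⟨k, by rw [hk, mul_comm]⟩

end Summit.BirchSwinnertonDyer.BirchSwinnertonDyer.Theorems.ManinLocalTwoThree

end
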